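import Mathlib
import HarnessLib
import Summits.HubbardSuperconductivity.HubbardSuperconductivity.Theorems.KLProgrammeKLRegimeSplitTwoLegSizesMSProfiles
import Summits.HubbardSuperconductivity.HubbardSuperconductivity.Theorems.KLProgrammeKLRegimeSplitTwoLegSizesMSScaleZeroBase

/-!
# Route `KLProgramme`, crux K3 — ENGINE child (`KLRegimeEngineV16`, `stub_twoLeg_scale0`, clause (E3a-MS-Q)): the (E3a-MS-TQ) slot conjunct
# `TwoLegSizesMSTQ … 0` AT SCALE `0` FROM THE ENGINE'S SCALE-0 PROFILES AND THE RESCALED PACKAGE LINES — no fit hypothesis left (k3c3-p1 g4)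

Seat hubbard-kl-k3c3-p1 (g4).  Composition, at Jackson degree `d = 4^0`, of the hypothesis-free Λ-supplier `twoLegSizesMSTQ_zero_of_pieces_mixed`
(`…TwoLegSizesMSLowMixed`), the Λ-shapes `msLam_three_le` / `msLam_four_le` at `n₀ = 0` (`Λ₃ ≤ 64·(8π⁸)·Gfr₁U²`, `Λ₄ ≤ 256·(8π⁸)·Gfr₁U²`),
the scale-0 fits `msPieceBaseL_le_scaleZero` / `msPieceSlotL_le_scaleZero` (`…TwoLegSizesMSScaleZero{Base,Slot}`, dilation covariance of k3c3-p3's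
arithmetic) and the chain regime `chain_regime_of_pieces_graded`.

**`twoLegSizesMSTQ_zero_of_profiles`** — binders: the KL regime, the frame as pieces, the engine's representation of `klLocalPart … 0 − K` by symbols
`S k` with sizes `σ k l`, one-piece responses `ε m l`, the cutoff bound `X`, the SCALE-0 PROFILE SHAPES (`σ 0 0 ≤ 16·mu 0·U²`, `σ k 1 ≤ 4·mu 1·U²`,
`σ k 2 ≤ mu 2·U²`, `σ k 3 ≤ mu 3·U²/4`, `σ k 4 ≤ mu 4·U²/16`, `σ k 5 ≤ mu 5·U²/64`; `ε m l ≤ nu_l·U²·(Gfr_l·U^{p_l}·4^{(l−2)m})` — the `n₀ = 0`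
instances of the general shapes) and the three RESCALED package lines (`msMuZ mu l = 16·mu l/4^l`, `msNuZ nu l = 4·nu l/4^l`, `msRenZ R = R[Gfr ↦ 16·Gfr]`):
`msReqSlot X (msMuZ mu) (msNuZ nu) (msRenZ R) (8π⁸) (8π⁸) j ≤ 64·Q.CE·G.S 1·R.Gfr j/4^j`, `msReqBase0 X (msMuZ mu) j ≤ 8·G.S j/4^j`,
`U·msReqBase1 X (msMuZ mu) (msRenZ R) (8π⁸) (8π⁸) j ≤ 8·G.S j/4^j` (`j ≤ 4`) — conclusion `TwoLegSizesMSTQ L M G Q R β U μ K 0`.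

Proofs only; nothing about the model.
-/

noncomputable section

namespace Summit.HubbardSuperconductivity.HubbardSuperconductivity.Theorems.KLRegimeSplit

set_option linter.dupNamespace false -- summit = problem name (single-conjunct summit), D-0017

open Real Finset Literature.MathematicalPhysics.QuantumLattice Literature.MathematicalPhysics.QuantumLattice.FermiRG
open Summit.HubbardSuperconductivity.HubbardSuperconductivity.Theorems.KLProgrammeLegKernels
open Summit.HubbardSuperconductivity.HubbardSuperconductivity.Theorems.DispersionFlow
open Summit.HubbardSuperconductivity.HubbardSuperconductivity.Theorems.PerturbedFermiCurve

/-- The order-3 low-part total at scale `0` in the dilated shape: `msLam R U (4^0) 0 3 ≤ 64·(8π⁸)·Gfr₁·U²`. -/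
theorem msLam_three_le_scaleZero {R : RenConsts} (hR : ∀ j, 0 ≤ R.Gfr j) (U : ℝ) :
    msLam R U (4 ^ 0) 0 3 ≤ 64 * (8 * π ^ 8) * R.Gfr 1 * U ^ 2 :=
  (msLam_three_le hR U 0).trans_eq (by ring)

/-- The order-4 low-part total at scale `0` in the dilated shape: `msLam R U (4^0) 0 4 ≤ 256·(8π⁸)·Gfr₁·U²`. -/
theorem msLam_four_le_scaleZero {R : RenConsts} (hR : ∀ j, 0 ≤ R.Gfr j) (U : ℝ) :
    msLam R U (4 ^ 0) 0 4 ≤ 256 * (8 * π ^ 8) * R.Gfr 1 * U ^ 2 :=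
  (msLam_four_le hR U 0).trans_eq (by ring)

section MS

variable {L M : ℕ} [NeZero L] [NeZero M] {G : GeoConsts} {Q : EngConsts} {R : RenConsts} {β U μ : ℝ}

/-- **(E3a-MS-TQ) AT SCALE `0` FROM THE ENGINE PROFILES** — `TwoLegSizesMSTQ L M G Q R β U μ K 0` with NO fit and NO low-part hypothesis:
the Λ-supplier `twoLegSizesMSTQ_zero_of_pieces_mixed` at `d = 4^0`, its fits discharged by `msPieceBaseL_le_scaleZero` / `msPieceSlotL_le_scaleZero`
at `lam3 = lam4 = 8π⁸`. -/
theorem twoLegSizesMSTQ_zero_of_profiles (hR : ∀ j, 0 ≤ R.Gfr j) {c : ℝ} (hc : 0 < c) (hcle : c ≤ klCurveC3 R / 16)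
    (hU : 0 < U) (hUle : U ≤ klCurveU0 R / 16) (hU1 : U ≤ 1) (hβmin : klBetaMin ≤ β) (hβc : β ≤ Real.exp (c / U ^ 2))
    (hμ : μ ∈ klWindowC)
    {K : TrigPolyC4v} {Kp : ℕ → TrigPolyC4v} (hK : ∀ p : Fin 2 → ℝ, K.eval p = ∑ m ∈ range (nScales β + 1), (Kp m).eval p)
    (ha : ∀ m ≤ nScales β, ∀ j ≤ 4, ∀ q : Momentum, ‖iteratedFDeriv ℝ j (evalM (Kp m)) q‖ ≤ pieceSize R U m j)
    (hc₀ : Continuous (klLocalPart L M β U μ K 0))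
    {S : ℕ → TrigPolyC4v}
    (hS : ∀ θ, klLocalPart L M β U μ K 0 θ - K.eval (klFermiPoint μ K θ) = (S (nScales β)).eval (klFermiPoint μ K θ))
    {σ : ℕ → ℕ → ℝ} (hσnn : ∀ k l, 0 ≤ σ k l)
    (hσ0 : ∀ k ≤ nScales β, ∀ q : Momentum, |evalM (S k) q| ≤ σ k 0)
    (hσ : ∀ k ≤ nScales β, ∀ l, 1 ≤ l → l ≤ 5 → ∀ q : Momentum, ‖iteratedFDeriv ℝ l (evalM (S k)) q‖ ≤ σ k l)
    {ε : ℕ → ℕ → ℝ} (hεnn : ∀ m l, 0 ≤ ε m l)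
    (hε0 : ∀ m ∈ Ioc 0 (nScales β), ∀ q : Momentum, |evalM (fsub (S m) (S (m - 1))) q| ≤ ε m 0)
    (hε : ∀ m ∈ Ioc 0 (nScales β), ∀ l, 1 ≤ l → l ≤ 4 → ∀ q : Momentum,
      ‖iteratedFDeriv ℝ l (evalM (fsub (S m) (S (m - 1)))) q‖ ≤ ε m l)
    {X : ℝ} (hX : ∀ l ≤ 4, ∀ x : ℝ, ‖iteratedFDeriv ℝ l salmhoferCutoff x‖ ≤ X)
    (hCE : 0 ≤ Q.CE) (hS' : ∀ j, 0 ≤ Q.S' j)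
    {mu nu : ℕ → ℝ} (hmu : ∀ i, 0 ≤ mu i) (hnu : ∀ i, 0 ≤ nu i)
    (hs0 : σ 0 0 ≤ 16 * mu 0 * U ^ 2)
    (hs1 : ∀ k ≤ nScales β, σ k 1 ≤ 4 * mu 1 * U ^ 2)
    (hs2 : ∀ k ≤ nScales β, σ k 2 ≤ mu 2 * U ^ 2)
    (hs3 : ∀ k ≤ nScales β, σ k 3 ≤ mu 3 * U ^ 2 / 4)
    (hs4 : ∀ k ≤ nScales β, σ k 4 ≤ mu 4 * U ^ 2 / 16)
    (hs5 : ∀ k ≤ nScales β, σ k 5 ≤ mu 5 * U ^ 2 / 64)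
    (he0 : ∀ m ∈ Ioc 0 (nScales β), ε m 0 ≤ nu 0 * U ^ 2 * (R.Gfr 0 * U / ((4 : ℝ) ^ m) ^ 2))
    (he1 : ∀ m ∈ Ioc 0 (nScales β), ε m 1 ≤ nu 1 * U ^ 2 * (R.Gfr 1 * U ^ 2 / (4 : ℝ) ^ m))
    (he2 : ∀ m ∈ Ioc 0 (nScales β), ε m 2 ≤ nu 2 * U ^ 2 * (R.Gfr 2 * U ^ 2))
    (he3 : ∀ m ∈ Ioc 0 (nScales β), ε m 3 ≤ nu 3 * U ^ 2 * (R.Gfr 3 * U ^ 2 * (4 : ℝ) ^ m))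
    (he4 : ∀ m ∈ Ioc 0 (nScales β), ε m 4 ≤ nu 4 * U ^ 2 * (R.Gfr 4 * U ^ 2 * ((4 : ℝ) ^ m) ^ 2))
    (hfit : ∀ j ≤ 4, msReqSlot X (msMuZ mu) (msNuZ nu) (msRenZ R) (8 * π ^ 8) (8 * π ^ 8) j ≤ 64 * (Q.CE * G.S 1 * R.Gfr j) / (4 : ℝ) ^ j)
    (hfit0 : ∀ j ≤ 4, msReqBase0 X (msMuZ mu) j ≤ 8 * G.S j / (4 : ℝ) ^ j)
    (hfit1 : ∀ j ≤ 4, U * msReqBase1 X (msMuZ mu) (msRenZ R) (8 * π ^ 8) (8 * π ^ 8) j ≤ 8 * G.S j / (4 : ℝ) ^ j) :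
    TwoLegSizesMSTQ L M G Q R β U μ K 0 := by
  -- the chain regime at scale `0`
  have hreg := chain_regime_of_pieces_graded hR hc hcle hU hUle hβmin hβc hμ ha (4 ^ 0) (Nat.zero_le (nScales β))
  have hA0 : 0 ≤ msA R c U := msA_nonneg hR hc.le U
  have hA20 : msA R c U ≤ 1 / 20 := hreg.2.1
  have hd : klCurveD ≤ msDt - 2 * msA R c U := hreg.2.2.1
  have hX0 : 0 ≤ X := le_trans (norm_nonneg _) (hX 0 (by norm_num) 0)
  have hlam : (0 : ℝ) ≤ 8 * π ^ 8 := by positivity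
  -- the Λ-shapes at `d = 4^0`
  have hΛ₃0 := msLam_nonneg hR U (4 ^ 0) 0 3
  have hΛ₄0 := msLam_nonneg hR U (4 ^ 0) 0 4
  have hΛ₃ := msLam_three_le_scaleZero hR U
  have hΛ₄ := msLam_four_le_scaleZero hR U
  refine twoLegSizesMSTQ_zero_of_pieces_mixed hR hc hcle hU hUle hβmin hβc hμ hK ha (4 ^ 0) hc₀ hS hσnn hσ0 hσ hεnn hε0 hε hX ?_ ?_
  · -- base fits
    exact msPieceBaseL_le_scaleZero hR hU hU1 hX0 hlam hlam hS' hmu hΛ₃0 hΛ₃ hΛ₄0 hΛ₄ hσnn hs0 (hs1 0 (Nat.zero_le _))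
      (hs2 0 (Nat.zero_le _)) (hs3 0 (Nat.zero_le _)) (hs4 0 (Nat.zero_le _)) hfit0 hfit1
  · -- slot fits
    intro m hm
    have hm' : 1 ≤ m := (mem_Ioc.mp hm).1
    have hk : m - 1 ≤ nScales β := by have := (mem_Ioc.mp hm).2; omega
    exact msPieceSlotL_le_scaleZero hR hU hU1 hm' hX0 hlam hlam hCE (hS' 1) hmu hnu hA0 hA20 hd hΛ₃0 hΛ₃ hΛ₄0 hΛ₄ hσnn
      (hs1 _ hk) (hs2 _ hk) (hs3 _ hk) (hs4 _ hk) (hs5 _ hk) hεnn (he0 m hm) (he1 m hm) (he2 m hm) (he3 m hm) (he4 m hm) hfit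

end MS

end Summit.HubbardSuperconductivity.HubbardSuperconductivity.Theorems.KLRegimeSplit

end
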